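import Summits.ValiantsHypothesis.ValiantsHypothesis.Theorems.LacunarySymmetroidMatrixDescartesCensusDefs
import Summits.ValiantsHypothesis.ValiantsHypothesis.Theorems.LacunarySymmetroidMatrixDescartesCensusTwistedRolleMult
import Summits.ValiantsHypothesis.ValiantsHypothesis.Theorems.LacunarySymmetroidMatrixDescartesStubDescartesCeiling
import Summits.ValiantsHypothesis.ValiantsHypothesis.Theorems.SymmetroidPencilBasics
import Literature.Algebra.Polynomial.DescartesSignVariations
import Literature.Computability.AlgebraicComplexity.RealTauKnownCases

/-!
# `MatrixDescartes` census — the SIGN-DEFINITE STRATUM of door A, for ALL supports and ALL formats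

HONEST FRAMING.  Object-search cell `pub-symmetroid`, door-A seat `val-sym-door-p1` (items
stmt-ValiantsHypothesis-19979 `DoorA26 = PosRootLawAt 2 6 19`, stmt-ValiantsHypothesis-19980 `DoorA34 = PosRootLawAt 3 4 18`;
both OPEN, never asserted here).  Every kernel upper bound of the cell toward door A is SUPPORT-BY-SUPPORT (BOX20, uniform
rays, record supports).  This file proves a small family of bounds that hold on EVERY support at once, by an argument
that does not see the support at all: **a pencil whose determinant keeps a (weak) sign on `(0, ∞)` has at most HALF the
Descartes count of distinct positive roots** — every positive root then has even multiplicity, and Descartes' rule counts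
roots WITH multiplicity (Mathlib `Polynomial.roots_countP_pos_le_signVariations`).  Consequences, all supports `d`, all `K`:

* `two_mul_card_posRoots_le_countP_of_weakSign` — the polynomial lemma: `p(x)·p(y) ≥ 0` for all `x, y > 0` ⇒
  `2 · #Z₊^{distinct}(p) ≤ #Z₊^{mult}(p)`;
* `two_mul_card_posRoots_det_succ_le_of_weakSign` — any `m × m` `K`-term pencil (no symmetry needed) whose determinant
  keeps a weak sign on `(0,∞)` has `2 · Z₊ + 1 ≤ C(m+K−1, m)`; at `(2,6)`: `Z₊ ≤ 10`, at `(3,4)`: `Z₊ ≤ 9`;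
* `two_mul_card_posRoots_det_succ_le_of_posSemidef` / `…_of_negSemidef` — all coefficients `S l` positive (resp.
  negative) semidefinite, any size `m` ⇒ the same (the pencil is semidefinite at every `x > 0`, so `det` keeps a sign);
* `two_mul_card_posRoots_det_succ_le_of_witnesses` — `m = 2`, symmetric letters: if ONE non-zero vector `u` has
  `uᵀ S_l u ≥ 0` for every `l` and ONE non-zero `v` has `vᵀ S_l v ≤ 0` for every `l`, then `F(x)` is never definite,
  `det F ≤ 0` on `(0,∞)`, and `2 · Z₊ + 1 ≤ C(K+1, 2)`; special cases: a COMMON ISOTROPIC VECTOR (`u = v`,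
  `…_of_commonIsotropic`) and the diagonal sign pattern `(S_l)₀₀ ≥ 0 ≥ (S_l)₁₁` for all `l` (`…_of_diagSigns`);
* the door-A readings at the K1 formats: `card_posRoots_le_ten_of_weakSign_two_six` (`(2,6)`: `Z₊ ≤ 10 < 19`),
  `card_posRoots_le_nine_of_weakSign_three_four` (`(3,4)`: `Z₊ ≤ 9 < 18`), and the semidefinite / witness corollaries.

What this is NOT: these strata are closed, measure-zero families (a hypothetical twenty has `det` changing sign 20
times); nothing here bounds `ζ_sym(2,6)` or `ζ_sym(3,4)`, decides `DoorA26`/`DoorA34`, or bears on `MatrixDescartes`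
(stmt-ValiantsHypothesis-18050) / `VP ≠ VNP`.  It records, in the door's own currency, the part of «all supports» that
needs no certificate.

[folklore] Descartes' rule of signs with multiplicity + parity of the root multiplicity at a sign-keeping root; elementary.
-/

-- `Summit.ValiantsHypothesis.ValiantsHypothesis.…` repeats a component by the D-0017 layout
-- (single-conjunct summit), which the `dupNamespace` linter flags; the name is mandated.
set_option linter.dupNamespace false

namespace Summit.ValiantsHypothesis.ValiantsHypothesis.Theorems.LacunarySymmetroidMatrixDescartes.Census

open Polynomial Finset
open scoped BigOperators Polynomial Matrix
open Summit.ValiantsHypothesis.ValiantsHypothesis.Theorems.MatrixDescartes.Negative (PosRootLawAt)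
open Summit.ValiantsHypothesis.ValiantsHypothesis.Theorems.SymmetroidDescartes (eval_det_pencil)

/-! ### The polynomial lemma: a sign-keeping polynomial has only even-multiplicity positive roots -/

/-- If `p ≠ 0` keeps a weak sign on `(0,∞)` (`p(x)·p(y) ≥ 0` for all positive `x, y`), then every positive root of
`p` has EVEN multiplicity (an odd-order root makes `p` change sign inside `(r/2, 2r)`). [folklore] -/
theorem even_rootMultiplicity_of_weakSign {p : ℝ[X]} (hp : p ≠ 0)
    (h : ∀ x y : ℝ, 0 < x → 0 < y → 0 ≤ p.eval x * p.eval y) {r : ℝ} (hr : 0 < r) :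
    Even (p.rootMultiplicity r) := by
  by_contra hodd
  rw [Nat.not_even_iff_odd] at hodd
  have hz : r ∈ Set.Ioo (r / 2) (2 * r) := ⟨by linarith, by linarith⟩
  obtain ⟨x, hx, y, hy, hxy⟩ :=
    Literature.Algebra.Polynomial.Descartes.exists_mul_eval_neg_of_odd_rootMultiplicity hp hz hodd
  have hx0 : 0 < x := by have := hx.1; linarith
  have hy0 : 0 < y := by have := hy.1; linarith
  exact absurd (h x y hx0 hy0) (not_le.mpr hxy)

/-- **Sign-keeping polynomials have at most half the Descartes count.**  If `p(x)·p(y) ≥ 0` for all `x, y > 0`, then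
twice the number of DISTINCT positive roots is at most the number of positive roots counted WITH multiplicity,
`2 · #Z₊^{distinct}(p) ≤ #Z₊^{mult}(p) = p.roots.countP (0 < ·)`. [folklore] -/
theorem two_mul_card_posRoots_le_countP_of_weakSign (p : ℝ[X])
    (h : ∀ x y : ℝ, 0 < x → 0 < y → 0 ≤ p.eval x * p.eval y) :
    2 * (p.roots.toFinset.filter (fun x => 0 < x)).card ≤ p.roots.countP (fun x => 0 < x) := by
  classical
  by_cases hp : p = 0
  · simp [hp]
  rw [countP_posRoots_eq_sum_rootMultiplicity, Finset.card_eq_sum_ones, Finset.mul_sum]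
  refine Finset.sum_le_sum fun r hr => ?_
  rw [Finset.mem_filter, Multiset.mem_toFinset] at hr
  have hroot : p.IsRoot r := (mem_roots hp).mp hr.1
  have hpos : 0 < p.rootMultiplicity r := (rootMultiplicity_pos hp).mpr hroot
  obtain ⟨k, hk⟩ := even_rootMultiplicity_of_weakSign hp h hr.2
  omega

/-- The same bound chained with Descartes' rule (with multiplicity) and the monomial count: a sign-keeping `p ≠ 0`
has `2 · #Z₊^{distinct}(p) + 1 ≤ #supp(p)`. [folklore] -/
theorem two_mul_card_posRoots_succ_le_card_support_of_weakSign {p : ℝ[X]} (hp : p ≠ 0)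
    (h : ∀ x y : ℝ, 0 < x → 0 < y → 0 ≤ p.eval x * p.eval y) :
    2 * (p.roots.toFinset.filter (fun x => 0 < x)).card + 1 ≤ p.support.card := by
  have h1 := two_mul_card_posRoots_le_countP_of_weakSign p h
  have h2 : p.roots.countP (fun x => 0 < x) ≤ p.signVariations := p.roots_countP_pos_le_signVariations
  have h3 := Literature.Computability.AlgebraicComplexity.signVariations_lt_card_support hp
  omega

/-! ### Pencils of any format whose determinant keeps a sign -/

/-- **All formats, all supports.**  For a `K`-term pencil of real `m × m` matrices (`K ≥ 1`; no symmetry needed)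
whose determinant keeps a weak sign on `(0,∞)` — `det F(x) · det F(y) ≥ 0` for all `x, y > 0` — the number `Z₊` of
distinct positive roots of `det F` satisfies `2 · Z₊ + 1 ≤ C(m+K−1, m)`: at most HALF the Descartes count
`C(m+K−1,m) − 1`. [folklore] -/
theorem two_mul_card_posRoots_det_succ_le_of_weakSign {K m : ℕ} (hK : 0 < K) (d : Fin K → ℕ)
    (S : Fin K → Matrix (Fin m) (Fin m) ℝ)
    (h : ∀ x y : ℝ, 0 < x → 0 < y → 0 ≤ (∑ l, x ^ d l • S l).det * (∑ l, y ^ d l • S l).det) :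
    2 * ((Matrix.det (∑ l, ((X : ℝ[X]) ^ d l) • (S l).map C)).roots.toFinset.filter
        (fun t => 0 < t)).card + 1 ≤ Nat.choose (m + K - 1) m := by
  have hch : 1 ≤ Nat.choose (m + K - 1) m := Nat.choose_pos (by omega)
  by_cases hp : Matrix.det (∑ l, ((X : ℝ[X]) ^ d l) • (S l).map C) = 0
  · rw [hp, Polynomial.roots_zero, Multiset.toFinset_zero, Finset.filter_empty, Finset.card_empty]
    omega
  have hsign : ∀ x y : ℝ, 0 < x → 0 < y →
      0 ≤ (Matrix.det (∑ l, ((X : ℝ[X]) ^ d l) • (S l).map C)).eval x *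
        (Matrix.det (∑ l, ((X : ℝ[X]) ^ d l) • (S l).map C)).eval y := by
    intro x y hx hy
    rw [eval_det_pencil S d x, eval_det_pencil S d y]
    exact h x y hx hy
  exact (two_mul_card_posRoots_succ_le_card_support_of_weakSign hp hsign).trans
    (StubDescartesCeiling.card_support_det_pencil_le d S)

/-- `(2,6)` reading: a six-term `2 × 2` pencil (symmetric or not, ANY support) whose determinant keeps a weak sign on
`(0,∞)` has at most `10` distinct positive det-roots — in particular it is no twenty (door A asks `≤ 19`). [folklore] -/
theorem card_posRoots_le_ten_of_weakSign_two_six (d : Fin 6 → ℕ) (S : Fin 6 → Matrix (Fin 2) (Fin 2) ℝ)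
    (h : ∀ x y : ℝ, 0 < x → 0 < y → 0 ≤ (∑ l, x ^ d l • S l).det * (∑ l, y ^ d l • S l).det) :
    ((Matrix.det (∑ l, ((X : ℝ[X]) ^ d l) • (S l).map C)).roots.toFinset.filter (fun t => 0 < t)).card ≤ 10 := by
  have := two_mul_card_posRoots_det_succ_le_of_weakSign (by norm_num) d S h
  have hc : Nat.choose (2 + 6 - 1) 2 = 21 := by decide
  omega

/-- `(3,4)` reading: a four-term `3 × 3` pencil (ANY support) whose determinant keeps a weak sign on `(0,∞)` has at
most `9` distinct positive det-roots (door A's companion asks `≤ 18`). [folklore] -/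
theorem card_posRoots_le_nine_of_weakSign_three_four (d : Fin 4 → ℕ) (S : Fin 4 → Matrix (Fin 3) (Fin 3) ℝ)
    (h : ∀ x y : ℝ, 0 < x → 0 < y → 0 ≤ (∑ l, x ^ d l • S l).det * (∑ l, y ^ d l • S l).det) :
    ((Matrix.det (∑ l, ((X : ℝ[X]) ^ d l) • (S l).map C)).roots.toFinset.filter (fun t => 0 < t)).card ≤ 9 := by
  have := two_mul_card_posRoots_det_succ_le_of_weakSign (by norm_num) d S h
  have hc : Nat.choose (3 + 4 - 1) 3 = 20 := by decide
  omega

/-! ### Semidefinite pencils (any size `m`) -/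

/-- A pencil with positive semidefinite coefficients is positive semidefinite at every `x ≥ 0`. [folklore] -/
theorem posSemidef_pencil_eval {K m : ℕ} (d : Fin K → ℕ) (S : Fin K → Matrix (Fin m) (Fin m) ℝ)
    (hS : ∀ l, (S l).PosSemidef) {x : ℝ} (hx : 0 ≤ x) : (∑ l, x ^ d l • S l).PosSemidef :=
  Matrix.posSemidef_sum Finset.univ fun l _ => (hS l).smul (pow_nonneg hx _)

/-- **PSD pencils, all formats, all supports**: if every `S l` is positive semidefinite then `det F ≥ 0` on `(0,∞)` and
`2 · Z₊ + 1 ≤ C(m+K−1, m)`. [folklore] -/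
theorem two_mul_card_posRoots_det_succ_le_of_posSemidef {K m : ℕ} (hK : 0 < K) (d : Fin K → ℕ)
    (S : Fin K → Matrix (Fin m) (Fin m) ℝ) (hS : ∀ l, (S l).PosSemidef) :
    2 * ((Matrix.det (∑ l, ((X : ℝ[X]) ^ d l) • (S l).map C)).roots.toFinset.filter
        (fun t => 0 < t)).card + 1 ≤ Nat.choose (m + K - 1) m := by
  classical
  refine two_mul_card_posRoots_det_succ_le_of_weakSign hK d S fun x y hx hy => ?_
  exact mul_nonneg (posSemidef_pencil_eval d S hS hx.le).det_nonneg
    (posSemidef_pencil_eval d S hS hy.le).det_nonneg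

/-- **NSD pencils** (every `−S l` positive semidefinite), all formats, all supports: the same bound
(`det(−F) = (−1)^m det F`, so the sign relation between two points is kept). [folklore] -/
theorem two_mul_card_posRoots_det_succ_le_of_negSemidef {K m : ℕ} (hK : 0 < K) (d : Fin K → ℕ)
    (S : Fin K → Matrix (Fin m) (Fin m) ℝ) (hS : ∀ l, (-S l).PosSemidef) :
    2 * ((Matrix.det (∑ l, ((X : ℝ[X]) ^ d l) • (S l).map C)).roots.toFinset.filter
        (fun t => 0 < t)).card + 1 ≤ Nat.choose (m + K - 1) m := by
  classical
  refine two_mul_card_posRoots_det_succ_le_of_weakSign hK d S fun x y hx hy => ?_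
  have ex : ∀ z : ℝ, (∑ l, z ^ d l • S l) = -(∑ l, z ^ d l • (-S l)) := by
    intro z
    rw [← Finset.sum_neg_distrib]
    exact Finset.sum_congr rfl fun l _ => by rw [smul_neg, neg_neg]
  have hdx := (posSemidef_pencil_eval d (fun l => -S l) hS hx.le).det_nonneg
  have hdy := (posSemidef_pencil_eval d (fun l => -S l) hS hy.le).det_nonneg
  rw [ex x, ex y, Matrix.det_neg, Matrix.det_neg, Fintype.card_fin]
  have : ((-1 : ℝ) ^ m * (∑ l, x ^ d l • -S l).det) * ((-1 : ℝ) ^ m * (∑ l, y ^ d l • -S l).det)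
      = ((-1 : ℝ) ^ m) ^ 2 * ((∑ l, x ^ d l • -S l).det * (∑ l, y ^ d l • -S l).det) := by ring
  rw [this]
  exact mul_nonneg (sq_nonneg _) (mul_nonneg hdx hdy)

/-- `(2,6)`: a symmetric-or-not six-term `2 × 2` pencil with PSD letters has at most `10` distinct positive det-roots on
every support. [folklore] -/
theorem card_posRoots_le_ten_of_posSemidef_two_six (d : Fin 6 → ℕ) (S : Fin 6 → Matrix (Fin 2) (Fin 2) ℝ)
    (hS : ∀ l, (S l).PosSemidef) :
    ((Matrix.det (∑ l, ((X : ℝ[X]) ^ d l) • (S l).map C)).roots.toFinset.filter (fun t => 0 < t)).card ≤ 10 := by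
  have := two_mul_card_posRoots_det_succ_le_of_posSemidef (by norm_num) d S hS
  have hc : Nat.choose (2 + 6 - 1) 2 = 21 := by decide
  omega

/-- `(3,4)`: a four-term `3 × 3` pencil with PSD letters has at most `9` distinct positive det-roots on every support.
[folklore] -/
theorem card_posRoots_le_nine_of_posSemidef_three_four (d : Fin 4 → ℕ) (S : Fin 4 → Matrix (Fin 3) (Fin 3) ℝ)
    (hS : ∀ l, (S l).PosSemidef) :
    ((Matrix.det (∑ l, ((X : ℝ[X]) ^ d l) • (S l).map C)).roots.toFinset.filter (fun t => 0 < t)).card ≤ 9 := by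
  have := two_mul_card_posRoots_det_succ_le_of_posSemidef (by norm_num) d S hS
  have hc : Nat.choose (3 + 4 - 1) 3 = 20 := by decide
  omega

/-! ### `m = 2`, symmetric letters: one weakly-positive and one weakly-negative direction for all letters at once -/

/-- For a real symmetric `2 × 2` matrix with positive determinant, the quadratic form has the strict sign of the `(0,0)`
entry at every non-zero vector: `M₀₀ · uᵀ M u > 0`. [folklore] -/
theorem mul_quadForm_pos_of_det_pos (M : Matrix (Fin 2) (Fin 2) ℝ) (hM : M.IsSymm) (hdet : 0 < M.det)
    (u : Fin 2 → ℝ) (hu : u ≠ 0) : 0 < M 0 0 * (u ⬝ᵥ (M *ᵥ u)) := by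
  have hs : M 1 0 = M 0 1 := by
    have h := congrFun (congrFun hM 0) 1
    simpa [Matrix.transpose_apply] using h
  rw [Matrix.det_fin_two, hs] at hdet
  have hq : u ⬝ᵥ (M *ᵥ u) = M 0 0 * u 0 ^ 2 + 2 * M 0 1 * u 0 * u 1 + M 1 1 * u 1 ^ 2 := by
    simp only [Matrix.mulVec, dotProduct, Fin.sum_univ_two, hs]
    ring
  rw [hq]
  have key : M 0 0 * (M 0 0 * u 0 ^ 2 + 2 * M 0 1 * u 0 * u 1 + M 1 1 * u 1 ^ 2)
      = (M 0 0 * u 0 + M 0 1 * u 1) ^ 2 + (M 0 0 * M 1 1 - M 0 1 * M 0 1) * u 1 ^ 2 := by ring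
  rw [key]
  have ha : M 0 0 ≠ 0 := by
    intro h0
    rw [h0] at hdet
    nlinarith [sq_nonneg (M 0 1)]
  by_cases hu1 : u 1 = 0
  · have hu0 : u 0 ≠ 0 := by
      intro h0
      apply hu
      funext i
      fin_cases i
      · exact h0
      · exact hu1
    have hsq : 0 < (M 0 0 * u 0 + M 0 1 * u 1) ^ 2 := by
      rw [hu1, mul_zero, add_zero]
      exact sq_pos_of_ne_zero (mul_ne_zero ha hu0)
    have : 0 ≤ (M 0 0 * M 1 1 - M 0 1 * M 0 1) * u 1 ^ 2 := mul_nonneg hdet.le (sq_nonneg _)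
    linarith
  · have h2 : 0 < (M 0 0 * M 1 1 - M 0 1 * M 0 1) * u 1 ^ 2 := mul_pos hdet (sq_pos_of_ne_zero hu1)
    have : 0 ≤ (M 0 0 * u 0 + M 0 1 * u 1) ^ 2 := sq_nonneg _
    linarith

/-- **Never-definite pencils, `m = 2`.**  Let the letters `S l` be symmetric and suppose ONE non-zero vector `u` satisfies
`uᵀ S_l u ≥ 0` for every `l` and ONE non-zero vector `v` satisfies `vᵀ S_l v ≤ 0` for every `l`.  Then at every `x > 0`
the matrix `F(x) = ∑ x^{d l} S l` is neither positive nor negative definite, so (being `2 × 2` symmetric) `det F(x) ≤ 0`.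
[folklore] -/
theorem det_pencil_eval_nonpos_of_witnesses {K : ℕ} (d : Fin K → ℕ) (S : Fin K → Matrix (Fin 2) (Fin 2) ℝ)
    (hS : ∀ l, (S l).IsSymm) (u v : Fin 2 → ℝ) (hu : u ≠ 0) (hv : v ≠ 0)
    (hu' : ∀ l, 0 ≤ u ⬝ᵥ (S l *ᵥ u)) (hv' : ∀ l, v ⬝ᵥ (S l *ᵥ v) ≤ 0) {x : ℝ} (hx : 0 < x) :
    (∑ l, x ^ d l • S l).det ≤ 0 := by
  set F := ∑ l, x ^ d l • S l with hF
  have hFs : F.IsSymm := by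
    rw [hF]
    unfold Matrix.IsSymm
    rw [Matrix.transpose_sum]
    exact Finset.sum_congr rfl fun l _ => by rw [Matrix.transpose_smul, (hS l).eq]
  have hquad : ∀ w : Fin 2 → ℝ, w ⬝ᵥ (F *ᵥ w) = ∑ l, x ^ d l * (w ⬝ᵥ (S l *ᵥ w)) := by
    intro w
    rw [hF, Matrix.sum_mulVec, dotProduct_sum]
    exact Finset.sum_congr rfl fun l _ => by rw [Matrix.smul_mulVec, dotProduct_smul, smul_eq_mul]
  have huF : 0 ≤ u ⬝ᵥ (F *ᵥ u) := by
    rw [hquad]; exact Finset.sum_nonneg fun l _ => mul_nonneg (pow_nonneg hx.le _) (hu' l)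
  have hvF : v ⬝ᵥ (F *ᵥ v) ≤ 0 := by
    rw [hquad]; exact Finset.sum_nonpos fun l _ => mul_nonpos_of_nonneg_of_nonpos (pow_nonneg hx.le _) (hv' l)
  by_contra hdet
  rw [not_le] at hdet
  have h1 := mul_quadForm_pos_of_det_pos F hFs hdet u hu
  have h2 := mul_quadForm_pos_of_det_pos F hFs hdet v hv
  rcases lt_trichotomy (F 0 0) 0 with h0 | h0 | h0
  · -- `F₀₀ < 0`: then `uᵀ F u < 0`, contradiction
    nlinarith
  · rw [h0, zero_mul] at h1; exact lt_irrefl _ h1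
  · -- `F₀₀ > 0`: then `vᵀ F v > 0`, contradiction
    nlinarith

/-- **Witness directions, all supports** (`m = 2`, symmetric letters, any `K ≥ 1`): one common weakly-positive direction
and one common weakly-negative direction force `det F ≤ 0` on `(0,∞)`, hence `2 · Z₊ + 1 ≤ C(K+1, 2)`. [folklore] -/
theorem two_mul_card_posRoots_det_succ_le_of_witnesses {K : ℕ} (hK : 0 < K) (d : Fin K → ℕ)
    (S : Fin K → Matrix (Fin 2) (Fin 2) ℝ) (hS : ∀ l, (S l).IsSymm) (u v : Fin 2 → ℝ) (hu : u ≠ 0) (hv : v ≠ 0)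
    (hu' : ∀ l, 0 ≤ u ⬝ᵥ (S l *ᵥ u)) (hv' : ∀ l, v ⬝ᵥ (S l *ᵥ v) ≤ 0) :
    2 * ((Matrix.det (∑ l, ((X : ℝ[X]) ^ d l) • (S l).map C)).roots.toFinset.filter
        (fun t => 0 < t)).card + 1 ≤ Nat.choose (2 + K - 1) 2 := by
  refine two_mul_card_posRoots_det_succ_le_of_weakSign hK d S fun x y hx hy => ?_
  exact mul_nonneg_of_nonpos_of_nonpos (det_pencil_eval_nonpos_of_witnesses d S hS u v hu hv hu' hv' hx)
    (det_pencil_eval_nonpos_of_witnesses d S hS u v hu hv hu' hv' hy)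

/-- **Common isotropic vector, all supports**: if one non-zero `u` is isotropic for every letter (`uᵀ S_l u = 0` for all
`l`), then `2 · Z₊ + 1 ≤ C(K+1,2)`; at `(2,6)` this is `Z₊ ≤ 10`. [folklore] -/
theorem two_mul_card_posRoots_det_succ_le_of_commonIsotropic {K : ℕ} (hK : 0 < K) (d : Fin K → ℕ)
    (S : Fin K → Matrix (Fin 2) (Fin 2) ℝ) (hS : ∀ l, (S l).IsSymm) (u : Fin 2 → ℝ) (hu : u ≠ 0)
    (hu' : ∀ l, u ⬝ᵥ (S l *ᵥ u) = 0) :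
    2 * ((Matrix.det (∑ l, ((X : ℝ[X]) ^ d l) • (S l).map C)).roots.toFinset.filter
        (fun t => 0 < t)).card + 1 ≤ Nat.choose (2 + K - 1) 2 :=
  two_mul_card_posRoots_det_succ_le_of_witnesses hK d S hS u u hu hu (fun l => (hu' l).ge) (fun l => (hu' l).le)

/-- **Diagonal sign pattern, all supports**: if every letter has `(S_l)₀₀ ≥ 0` and `(S_l)₁₁ ≤ 0` (witnesses `e₀`, `e₁`),
then `2 · Z₊ + 1 ≤ C(K+1,2)`. [folklore] -/
theorem two_mul_card_posRoots_det_succ_le_of_diagSigns {K : ℕ} (hK : 0 < K) (d : Fin K → ℕ)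
    (S : Fin K → Matrix (Fin 2) (Fin 2) ℝ) (hS : ∀ l, (S l).IsSymm)
    (h0 : ∀ l, 0 ≤ S l 0 0) (h1 : ∀ l, S l 1 1 ≤ 0) :
    2 * ((Matrix.det (∑ l, ((X : ℝ[X]) ^ d l) • (S l).map C)).roots.toFinset.filter
        (fun t => 0 < t)).card + 1 ≤ Nat.choose (2 + K - 1) 2 := by
  refine two_mul_card_posRoots_det_succ_le_of_witnesses hK d S hS (Pi.single 0 1) (Pi.single 1 1) ?_ ?_ ?_ ?_
  · intro h; have := congrFun h 0; simp at this
  · intro h; have := congrFun h 1; simp at this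
  · intro l
    have : (Pi.single 0 1 : Fin 2 → ℝ) ⬝ᵥ (S l *ᵥ Pi.single 0 1) = S l 0 0 := by
      simp [Matrix.mulVec, dotProduct, Fin.sum_univ_two]
    rw [this]; exact h0 l
  · intro l
    have : (Pi.single 1 1 : Fin 2 → ℝ) ⬝ᵥ (S l *ᵥ Pi.single 1 1) = S l 1 1 := by
      simp [Matrix.mulVec, dotProduct, Fin.sum_univ_two]
    rw [this]; exact h1 l

/-- `(2,6)` door-A reading of the witness stratum: symmetric six-term `2 × 2` pencils with a common weakly-positive and a
common weakly-negative direction have at most `10` distinct positive det-roots, on every support. [folklore] -/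
theorem card_posRoots_le_ten_of_witnesses_two_six (d : Fin 6 → ℕ) (S : Fin 6 → Matrix (Fin 2) (Fin 2) ℝ)
    (hS : ∀ l, (S l).IsSymm) (u v : Fin 2 → ℝ) (hu : u ≠ 0) (hv : v ≠ 0)
    (hu' : ∀ l, 0 ≤ u ⬝ᵥ (S l *ᵥ u)) (hv' : ∀ l, v ⬝ᵥ (S l *ᵥ v) ≤ 0) :
    ((Matrix.det (∑ l, ((X : ℝ[X]) ^ d l) • (S l).map C)).roots.toFinset.filter (fun t => 0 < t)).card ≤ 10 := by
  have := two_mul_card_posRoots_det_succ_le_of_witnesses (by norm_num) d S hS u v hu hv hu' hv'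
  have hc : Nat.choose (2 + 6 - 1) 2 = 21 := by decide
  omega

end Summit.ValiantsHypothesis.ValiantsHypothesis.Theorems.LacunarySymmetroidMatrixDescartes.Census
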